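import Literature.NumberTheory.LFunctions.SchoenfeldBrentSieve

/-!
# Brent's range of Schoenfeld 1976, Cor. 1 — block 09: `[1880813695, 2084237439)`

Topic: `Literature/NumberTheory/LFunctions`. COMPUTATIONAL (one `native_decide`, `≈ 60–80 s`): the `97`
segments of `2²¹` integers of the certified checker of `SchoenfeldBrentSieve.lean` based at
`N = 1880813694` pass every cell check of `|π(x) − li(x)| < 4613.5`, entering with `π(1880813694) = 92649476` and
leaving with `π(2084237438) = 102152276`. Consumed by the assembly `SchoenfeldExplicitBrentProofs.lean`
through `BrentSieve.brentOK_step` (discharge of `Literature.NumberTheory.LFunctions.Schoenfeld1976_brentRange`).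

## References

* L. Schoenfeld, Math. Comp. 30 (1976), 337–360, proof of Cor. 1 (p. 340). [Schoenfeld1976]
* R. P. Brent, Math. Comp. 29 (1975), 43–56, Table 1. [Brent1975]
-/

namespace Literature.NumberTheory.LFunctions

namespace BrentSieve

/-- Block 09 of the certified check of Brent's range: `checkChunk 1880813694 97 92649476 102152276`. [folklore] -/
theorem checkChunk_09 : checkChunk 1880813694 97 92649476 102152276 = true := by
  native_decide

end BrentSieve

end Literature.NumberTheory.LFunctions
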